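import Literature.IUT.HodgeTheaters.PuncturedEllipticCoveringsEps0RamificationOfOrientedInertia
import Literature.IUT.HodgeTheaters.PuncturedEllipticCoveringsCor12InertiaCentralOfCuspGalois
import Mathlib.GroupTheory.GroupAction.ConjAct
import Mathlib.Tactic.Group
import HarnessLib

/-!
# [IUTchI] §1 / Cor. 1.2: the ORIENTATION of `ι̲` on the zero-cusp inertia `I_{ε⁰}` (law (O2) of p499258)
# DERIVED from «`ι` acts by `−1` on `Δ_X^{ab} ⊗ ℤ/l`» via the mod-`l` Heisenberg quotient of `Δ_X ≅ F̂₂` — proof-only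

Mochizuki, *Inter-universal Teichmüller theory I: construction of Hodge theaters*, kurims manuscript (May 2020), §1
p. 37 l. 20–24 (the assumption (∗)), p. 38 l. 1 («`ι` acts on `Δ_E ⊗ (ℤ/lℤ)` via multiplication by `−1`») and Cor. 1.2,
proof p. 39 l. 28–31 [cite: Mochizuki2012, IUTchI §1 pp.37-39] (D-0012 claim key; series status DISPUTED — nothing of
the series is asserted here); [AbsTopIII] Prop. 1.4 (i)(ii) p. 31 (cusp inertia `⟨[a,b]⟩⁻`; the cuspidally central
quotient) [cite: MochizukiAbsTopIII2015, Prop 1.4 p.31].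

PROOF-ONLY companion (cell abc-iut, seat abc-iut-w6-d032 gen 8, self-row «EPS0-ORIENTATION-FROM-IOTA-NEG»; no `def`,
no instance, no notation, no new `Prop` fact; nothing restated) over abc-iut-w6-d032's
`…Eps0RamificationOfOrientedInertia.lean` (p499258: the GAP binder `h0 : ¬ I_{ε⁰} ⊆ Π_{X̲→}` (G-L5d4g6-1) of the
[IUTchI] Cor. 1.2 closers ⟸ the orientation laws (O1) «`z₀ z₁ z₂ ∈ Ker(Δ_X̲ ↠ Δ_ε)`» and (O2) «`ι̲ z ι̲⁻¹ z⁻¹ ∈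
Ker(Δ_X̲ ↠ Δ_X̲^{ab} ⊗ ℤ/l)` for `z ∈ I_{ε⁰}`, `ι̲ ∈ Δ_C̲ ∖ Δ_X̲`»), abc-iut-L5-t1's `…Cor12InertiaCentralOfStar.lean`
(p500241: (L4) ⟸ (∗) + (A) + (c′) + (r) by the mod-`l` Heisenberg quotient `φ : Δ_X ↠ H(ℤ/l)`) and abc-iut-w4-d051's
`…Cor12InertiaCentralOfCuspGalois.lean` (p501910: (r) ⟸ `CuspGalois`).

WHAT THIS FILE PROVES.  (O2) is NOT an independent input: it follows from the cusp action `C : D.CuspGalois` (`act_ε0`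
«`ι̲` fixes `ε⁰`», `act_decomp`), the origin data (A) «`Δ_X` free profinite on `a, b`» + (c′) «every `I_x` a
`Δ_X`-conjugate of `⟨[a,b]⟩⁻`» (abc-iut-L5-t1's `GeomOrigin`), the datum's own field (∗) `star`, and ONE (∗)-shaped ι-law
  (N) `∀ c ∈ Δ_C̲ ∖ Δ_X̲, ∀ p ∈ Δ_X, c p c⁻¹ · p ∈ (⁅Δ_X, Δ_X⁆ · Δ_X^l)⁻` — «`ι` acts on `Δ_X^{ab} ⊗ ℤ/l` by `−1`»
(print states it for the quotient `Δ_E ⊗ ℤ/l`, p. 38 l. 1; classically `[−1]_E = −1` on `E[l]`; implied at once by an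
origin field «`ι` inverts `a`, `b` up to `Δ_X`-conjugacy», `C = X/{±1}`) — the literal subgroup of `star` with «trivially»
replaced by «by `−1`».  THE GROUP THEORY («`χ(ι) = det(−1) = +1`», the Weil pairing inside `F̂₂`): let `c ∈ Δ_C̲ ∖ Δ_X̲`,
`z ∈ I_{ε⁰}`.  By `act_ε0` + `act_decomp` some `d := t c` (`t ∈ Π_X̲`) normalises `D_{ε⁰}`, so `z″ := d z d⁻¹ ∈ I_{ε⁰}`
and `c z c⁻¹ z⁻¹ = [t⁻¹, z″] · (z″ z⁻¹)`.  The first factor lies in `Ker(Δ_X̲ ↠ Δ_X̲^{ab} ⊗ ℤ/l)` by (L4), a THEOREM of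
(∗) + (A) + (c′) + `C` (p500241 + p501910).  For the second let `φ : Δ_X → H(ℤ/l)` be the Heisenberg quotient (`a ↦ x`,
`b ↦ y`, `[x, y]` central of order `l`; commutators and `l`-th powers central).  By (∗) (for `t`) and (N) (for `c`),
conjugation by `d` sends `p ∈ Δ_X` to `n_p · p⁻¹` with `φ(n_p)` central, and in the class-`2` group `H(ℤ/l)`
`[u₁ x⁻¹, u₂ y⁻¹] = [x⁻¹, y⁻¹] = [x, y]` for central `u_i` — `−1 ∈ GL₂(ℤ/l)` acts on `∧² = μ_l` through `det(−1) = +1`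
— so `φ ∘ c_d = φ` on the commutators, hence (closed equaliser, discrete target) on `⁅Δ_X, Δ_X⁆⁻ ⊇ I_{ε⁰}`; thus
`φ(z″ z⁻¹) = 1`, and since `I_{ε⁰} = ⟨w⟩⁻` with `φ(w)` of order `l`, `z″ z⁻¹ ∈ ⟨w^l⟩⁻ ⊆ (Δ_X̲^l)⁻ ⊆ Ker`.  ∎
CONSEQUENCE (sequel file): the GAP binder `h0` ⟸ (O1) + (N) + the printed label clauses (L2a)(L2c)(L3), via p499258;
abc-iut-L5-d4's R45 census item (iii) «`h0` descends only with the ι-field» sharpens to «`h0 ⟸ (O1) + (N)`», (N) being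
the (∗)-analogue an ι-origin field supplies; no orientation datum at `ε⁰` is ever needed.

HONEST FRAMING: classical profinite group theory about OUR typed interface; (∗) is the datum's own hypothesis FIELD,
(A)/(c′)/(N) are assumption-shaped binders asserted for no instance, `C` is the interface datum of p424023; this file
DERIVES (O2) from them and discharges no FACT-LIST item; typed ≠ inhabited ≠ discharged; nothing here bears on
[IUTchIII] Cor. 3.12 or asserts that abc is proved or refuted; no printed statement is strengthened.  §1 re-proves
locally, as `private` lemmas adapted from p500241 (where they are `private`), the finite Heisenberg test group and the
procyclic-kernel lemma.
-/

noncomputable section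

open Topology

namespace Literature.IUT.HodgeTheaters

namespace PuncturedEllipticData

open scoped Pointwise
open Literature.AnabelianGeometry.AbsoluteAnabelian Literature.GroupTheory

universe u

/-! ### §1. Plumbing: the finite Heisenberg test group; class-`2` commutator identities; procyclic kernels -/

/-- **The finite Heisenberg group `H(ℤ/l)`** as the tree's twisted product `(ℤ/l)² ×_c ℤ/l` (`c(v, w) = v₁ w₂`): a
finite group with a CENTRAL subgroup `Z = Ker(H ↠ (ℤ/l)²)` containing all commutators and all `l`-th powers, and two
elements `x, y` with `[x, y]` of order exactly `l` (adapted from p500241, `private` there; cf. abc-iut-L4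
`FreeProfiniteCommutatorCusp`). [cite: MochizukiAbsTopIII2015, Prop 1.4 (ii) p.31] -/
private theorem exists_finite_heisenberg (l : ℕ) (hl : 0 < l) :
    ∃ (K : Type) (_ : Group K) (_ : Finite K) (Z : Subgroup K) (x y : K),
      Z ≤ Subgroup.center K ∧ (∀ p q : K, p * q * p⁻¹ * q⁻¹ ∈ Z) ∧ (∀ p : K, p ^ l ∈ Z) ∧
        orderOf (x * y * x⁻¹ * y⁻¹) = l := by
  haveI : NeZero l := ⟨hl.ne'⟩
  let c : CentralCocycle (Multiplicative (ZMod l × ZMod l)) (Multiplicative (ZMod l)) :=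
    { toFun := fun g h =>
        Multiplicative.ofAdd ((Multiplicative.toAdd g).1 * (Multiplicative.toAdd h).2)
      cocycle' := fun g h k => by
        rw [← ofAdd_add, ← ofAdd_add, toAdd_mul, toAdd_mul, Prod.fst_add, Prod.snd_add]
        congr 1
        ring
      map_one_one' := by
        rw [toAdd_one, Prod.fst_zero, zero_mul, ofAdd_zero] }
  let x : TwistedProduct c := ⟨Multiplicative.ofAdd (1, 0), 1⟩
  let y : TwistedProduct c := ⟨Multiplicative.ofAdd (0, 1), 1⟩
  have hxy' : x * y = TwistedProduct.inl c (Multiplicative.ofAdd 1) * (y * x) := by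
    refine TwistedProduct.ext ?_ ?_
    · change Multiplicative.ofAdd ((1 : ZMod l), (0 : ZMod l)) * Multiplicative.ofAdd (0, 1) =
        1 * (Multiplicative.ofAdd (0, 1) * Multiplicative.ofAdd (1, 0))
      rw [one_mul, mul_comm]
    · change (1 : Multiplicative (ZMod l)) * 1 * Multiplicative.ofAdd ((1 : ZMod l) * 1) =
        Multiplicative.ofAdd (1 : ZMod l) * (1 * 1 * Multiplicative.ofAdd ((0 : ZMod l) * 0)) *
          c 1 (Multiplicative.ofAdd (0, 1) * Multiplicative.ofAdd (1, 0))
      rw [CentralCocycle.map_one_left, mul_one, mul_zero, ofAdd_zero, mul_one, one_mul, one_mul,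
        mul_one, mul_one]
  have hxy : x * y * x⁻¹ * y⁻¹ = TwistedProduct.inl c (Multiplicative.ofAdd 1) := by
    simp only [hxy', mul_assoc, mul_inv_cancel, mul_one]
  refine ⟨TwistedProduct c, inferInstance, ?_, (TwistedProduct.fst c).ker, x, y, ?_, ?_, ?_, ?_⟩
  · exact Finite.of_equiv (Multiplicative (ZMod l × ZMod l) × Multiplicative (ZMod l))
      ⟨fun p => ⟨p.1, p.2⟩, fun z => (z.g, z.a), fun _ => rfl, fun _ => rfl⟩
  · intro z hz
    rw [← TwistedProduct.range_inl_eq_ker_fst] at hz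
    obtain ⟨a, rfl⟩ := hz
    exact TwistedProduct.inl_mem_center _
  · have hcomm : ∀ a b : Multiplicative (ZMod l × ZMod l), a * b * a⁻¹ * b⁻¹ = 1 := fun a b => by
      rw [mul_right_comm a b a⁻¹, mul_inv_cancel, one_mul, mul_inv_cancel]
    intro p q
    rw [MonoidHom.mem_ker, map_mul, map_mul, map_mul, map_inv, map_inv]
    exact hcomm _ _
  · intro p
    rw [MonoidHom.mem_ker, map_pow, ← ofAdd_toAdd (TwistedProduct.fst c p), ← ofAdd_nsmul]
    have h0 : l • Multiplicative.toAdd (TwistedProduct.fst c p) = 0 := by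
      ext <;> simp
    rw [h0, ofAdd_zero]
  · rw [hxy, orderOf_injective (TwistedProduct.inl c) TwistedProduct.inl_injective,
      orderOf_ofAdd_eq_addOrderOf, ZMod.addOrderOf_one]

/-- Commutators do not see CENTRAL translates: `[u₁ a, u₂ b] = [a, b]` for `u₁, u₂ ∈ Z(K)` (adapted from p500241).
[folklore] -/
private theorem commutator_central_mul {K : Type*} [Group K] {u₁ u₂ : K} (h₁ : u₁ ∈ Subgroup.center K)
    (h₂ : u₂ ∈ Subgroup.center K) (a b : K) :
    (u₁ * a) * (u₂ * b) * (u₁ * a)⁻¹ * (u₂ * b)⁻¹ = a * b * a⁻¹ * b⁻¹ := by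
  have c₁i := Subgroup.mem_center_iff.mp (inv_mem h₁)
  have c₂i := Subgroup.mem_center_iff.mp (inv_mem h₂)
  have pull₁i : ∀ X Y : K, X * (u₁⁻¹ * Y) = u₁⁻¹ * (X * Y) := fun X Y => by
    rw [← mul_assoc, c₁i X, mul_assoc]
  have pull₂i : ∀ X Y : K, X * (u₂⁻¹ * Y) = u₂⁻¹ * (X * Y) := fun X Y => by
    rw [← mul_assoc, c₂i X, mul_assoc]
  simp only [mul_inv_rev, mul_assoc]
  rw [pull₁i a⁻¹, pull₁i b, pull₁i u₂, pull₁i a, mul_inv_cancel_left, c₂i b⁻¹, pull₂i a⁻¹, pull₂i b,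
    mul_inv_cancel_left]

/-- **`det(−1) = +1` in class `2`**: if the commutator `[a, b]` is central then `[a⁻¹, b⁻¹] = [a, b]` — the involution
`−1` of the abelianisation acts trivially on commutators. [folklore] -/
private theorem commutator_inv_inv_of_central {K : Type*} [Group K] (a b : K)
    (h : a * b * a⁻¹ * b⁻¹ ∈ Subgroup.center K) :
    a⁻¹ * b⁻¹ * a⁻¹⁻¹ * b⁻¹⁻¹ = a * b * a⁻¹ * b⁻¹ := by
  have hc := Subgroup.mem_center_iff.mp h (a⁻¹ * b⁻¹)
  calc a⁻¹ * b⁻¹ * a⁻¹⁻¹ * b⁻¹⁻¹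
      = (a⁻¹ * b⁻¹ * (a * b * a⁻¹ * b⁻¹)) * (b * a) := by group
    _ = (a * b * a⁻¹ * b⁻¹ * (a⁻¹ * b⁻¹)) * (b * a) := by rw [hc]
    _ = a * b * a⁻¹ * b⁻¹ := by group

/-- **Kernels on a procyclic closure**: if `φ` (continuous, to a discrete group, defined on a closed subgroup
`Δ ∋ w`) has `φ(w)` of order `l ≥ 1`, then an element of `⟨w⟩⁻` killed by `φ` lies in `⟨w^l⟩⁻` — because
`⟨w⟩⁻ = ⋃_{i<l} wⁱ · ⟨w^l⟩⁻` (adapted verbatim from p500241, `private` there). [folklore] -/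
private theorem mem_closure_zpowers_pow_of_map_eq_one {P : Type*} [Group P] [TopologicalSpace P]
    [IsTopologicalGroup P] {K : Type*} [Group K] [TopologicalSpace K] [DiscreteTopology K]
    {Δ : Subgroup P} (hΔ : IsClosed (Δ : Set P)) {φ : Δ →* K} (hφ : Continuous φ)
    {w : P} (hw : w ∈ Δ) {l : ℕ} (hl : 0 < l) (hord : orderOf (φ ⟨w, hw⟩) = l)
    {u : P} (hu : u ∈ (Subgroup.zpowers w).topologicalClosure) (huΔ : u ∈ Δ)
    (hφu : φ ⟨u, huΔ⟩ = 1) : u ∈ (Subgroup.zpowers (w ^ l)).topologicalClosure := by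
  set V := (Subgroup.zpowers (w ^ l)).topologicalClosure with hV
  have hVc : IsClosed (V : Set P) := Subgroup.isClosed_topologicalClosure _
  have hVΔ : V ≤ Δ :=
    Subgroup.topologicalClosure_minimal _ (by rw [Subgroup.zpowers_le]; exact Δ.pow_mem hw l) hΔ
  have hkc : IsClosed ((φ.ker.map Δ.subtype : Subgroup P) : Set P) := by
    rw [Subgroup.coe_map, Subgroup.coe_subtype]
    exact hΔ.isClosedEmbedding_subtypeVal.isClosedMap _
      (by rw [MonoidHom.coe_ker]; exact (isClosed_discrete _).preimage hφ)
  have hVk : V ≤ φ.ker.map Δ.subtype := by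
    refine Subgroup.topologicalClosure_minimal _ ?_ hkc
    rw [Subgroup.zpowers_le]
    refine ⟨⟨w, hw⟩ ^ l, ?_, rfl⟩
    change (⟨w, hw⟩ : Δ) ^ l ∈ φ.ker
    rw [MonoidHom.mem_ker, map_pow, ← hord, pow_orderOf_eq_one]
  have hVker : ∀ v (hv : v ∈ V), φ ⟨v, hVΔ hv⟩ = 1 := by
    intro v hv
    obtain ⟨v', hv', hvv'⟩ := hVk hv
    have h : (⟨v, hVΔ hv⟩ : Δ) = v' := Subtype.ext hvv'.symm
    rw [h]
    exact hv'
  set C : Set P := ⋃ i ∈ Finset.range l, (fun p => w ^ i * p) '' (V : Set P) with hC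
  have hCc : IsClosed C := by
    refine Set.Finite.isClosed_biUnion (Finset.range l).finite_toSet fun i _ => ?_
    rw [← Homeomorph.coe_mulLeft]
    exact (Homeomorph.mulLeft (w ^ i)).isClosed_image.mpr hVc
  have hl0 : (0 : ℤ) < l := by exact_mod_cast hl
  have hsub : ((Subgroup.zpowers w : Subgroup P) : Set P) ⊆ C := by
    intro p hp
    obtain ⟨k, rfl⟩ := Subgroup.mem_zpowers_iff.mp hp
    have hi0 : (0 : ℤ) ≤ k % l := Int.emod_nonneg _ hl0.ne'
    have hil : k % l < l := Int.emod_lt_of_pos _ hl0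
    have hii : ((k % l).toNat : ℤ) = k % l := Int.toNat_of_nonneg hi0
    have hilt : (k % l).toNat < l := by omega
    refine Set.mem_iUnion₂.mpr ⟨(k % l).toNat, Finset.mem_range.mpr hilt, (w ^ l) ^ (k / l), ?_, ?_⟩
    · exact Subgroup.le_topologicalClosure _ (Subgroup.mem_zpowers_iff.mpr ⟨k / l, rfl⟩)
    · change w ^ (k % l).toNat * (w ^ l) ^ (k / l) = w ^ k
      rw [← zpow_natCast w (k % l).toNat, hii, ← zpow_natCast w l, ← zpow_mul, ← zpow_add,
        Int.emod_add_mul_ediv]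
  have huC : u ∈ C := by
    have hcl : closure ((Subgroup.zpowers w : Subgroup P) : Set P) ⊆ C := hCc.closure_subset_iff.mpr hsub
    apply hcl
    rw [← Subgroup.topologicalClosure_coe]
    exact hu
  rw [hC, Set.mem_iUnion₂] at huC
  obtain ⟨i, hi, v, hv, hvu'⟩ := huC
  have hvu : w ^ i * v = u := hvu'
  have hvΔ : v ∈ Δ := hVΔ hv
  have hφv : φ ⟨v, hvΔ⟩ = 1 := hVker v hv
  have hwi : (⟨u, huΔ⟩ : Δ) = ⟨w, hw⟩ ^ i * ⟨v, hvΔ⟩ := Subtype.ext (by simp [← hvu])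
  have h1 : φ ⟨w, hw⟩ ^ i = 1 := by
    have h := hφu
    rwa [hwi, map_mul, map_pow, hφv, mul_one] at h
  have hi0' : i = 0 := by
    have hdvd : l ∣ i := by rw [← hord]; exact orderOf_dvd_of_pow_eq_one h1
    exact Nat.eq_zero_of_dvd_of_lt hdvd (Finset.mem_range.mp hi)
  rw [← hvu, hi0', pow_zero, one_mul]
  exact hv

/-! ### §2. (O2) from (N) + (∗) + (A) + (c′) + the cusp action -/

namespace CuspGalois

variable {D : PuncturedEllipticData.{u}} (C : D.CuspGalois)

include C in
/-- **The orientation law (O2) of p499258 DERIVED**: for `c ∈ Δ_C̲ ∖ Δ_X̲` and `z ∈ I_{ε⁰}`, `c z c⁻¹ z⁻¹ ∈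
Ker(Δ_X̲ ↠ Δ_X̲^{ab} ⊗ ℤ/l)` — «the geometric involution carries a generator of `I_{ε⁰}` to a conjugate of ITSELF» — from
the cusp action `C` (`act_ε0`, `act_decomp`), (A) `Δ_X` free profinite on `a, b`, (c′) every `I_x` a `Δ_X`-conjugate of
`⟨[a,b]⟩⁻`, the field (∗) `star`, and (N) «`ι` acts on `Δ_X^{ab} ⊗ ℤ/l` by `−1`»; proof by the mod-`l` Heisenberg quotient
of `F̂₂`, `−1` acting on its centre through `det(−1) = +1`. ([IUTchI] Cor 1.2 p.39) [claim: Mochizuki2012, status: disputed] -/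
theorem inertia_ε0_conj_mem_modLKer_of_iotaNeg_freePro {gens : Fin 2 → ↥(D.PiX ⊓ D.DeltaC)}
    (hfree : IsFreeProOn ↥(D.PiX ⊓ D.DeltaC) Set.univ gens)
    (hcusp : ∀ x : D.Cusp, ∃ g ∈ D.PiX ⊓ D.DeltaC,
      D.inertia x = (Subgroup.zpowers (g * ((gens 0 : D.PiC) * (gens 1 : D.PiC) *
        (gens 0 : D.PiC)⁻¹ * (gens 1 : D.PiC)⁻¹) * g⁻¹)).topologicalClosure)
    (hneg : ∀ c ∈ D.DeltaCbar, c ∉ D.DeltaXbar → ∀ p ∈ D.PiX ⊓ D.DeltaC,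
      c * p * c⁻¹ * p ∈ (⁅D.PiX ⊓ D.DeltaC, D.PiX ⊓ D.DeltaC⁆ ⊔
        Subgroup.closure ((fun y : D.PiC => y ^ D.l) ''
          ((D.PiX ⊓ D.DeltaC : Subgroup D.PiC) : Set D.PiC))).topologicalClosure) :
    ∀ c ∈ D.DeltaCbar, c ∉ D.DeltaXbar → ∀ z ∈ D.inertia D.ε0,
      c * z * c⁻¹ * z⁻¹ ∈ D.modLKer := by
  classical
  intro c hc hcX z hz
  have hΔc : IsClosed ((D.PiX ⊓ D.DeltaC : Subgroup D.PiC) : Set D.PiC) := D.isClosed_piX_inf_deltaC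
  haveI hΔn : (D.PiX ⊓ D.DeltaC).Normal := by
    haveI := D.piX_normal
    haveI : D.DeltaC.Normal := D.E.normal_geom
    exact Subgroup.normal_inf_normal D.PiX D.DeltaC
  have hl : 0 < D.l := by have := D.five_le; omega
  -- (L4), a THEOREM of (∗) + (A) + (c′) + the cusp action (p500241 + p501910)
  have hL4 : ∀ x : D.Cusp, ∀ g ∈ D.PiXbar, ∀ z ∈ D.inertia x, g * z * g⁻¹ * z⁻¹ ∈ D.modLKer :=
    C.inertia_central_of_star_freePro hfree hcusp
  -- `c ∈ Π_C̲` fixes `ε⁰` (`act_ε0`), so `d := t c` normalises `D_{ε⁰}` for some `t ∈ Π_X̲` (`act_decomp`)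
  have hcCbar : c ∈ D.PiCbar := (show c ∈ D.PiCbar ⊓ D.DeltaC from hc).1
  obtain ⟨t, ht, hz''⟩ := C.exists_conj_inertia_mem c D.ε0 hz
  rw [C.act_ε0 c hcCbar] at hz''
  have htX : t ∈ D.PiX := (show t ∈ D.PiX ⊓ D.PiCbar from ht).1
  set d : D.PiC := t * c with hddef
  set z'' : D.PiC := d * z * d⁻¹ with hz''def
  -- `c z c⁻¹ z⁻¹ = [t⁻¹, z″] · (z″ z⁻¹)`; the first factor is (L4)
  have hid : c * z * c⁻¹ * z⁻¹ = (t⁻¹ * z'' * t⁻¹⁻¹ * z''⁻¹) * (z'' * z⁻¹) := by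
    rw [hz''def, hddef]; group
  rw [hid]
  refine mul_mem (hL4 D.ε0 t⁻¹ (inv_mem ht) z'' hz'') ?_
  -- the Heisenberg quotient `φ : Δ_X → H(ℤ/l)`
  obtain ⟨K, _, _, Z, xK, yK, hZc, hZcomm, hZpow, hord⟩ := exists_finite_heisenberg D.l hl
  letI : TopologicalSpace K := ⊥
  haveI : DiscreteTopology K := ⟨rfl⟩
  obtain ⟨φ, hφc, hφa, hφb⟩ := hfree.exists_continuous_hom_pair (fun p _ => Set.mem_univ p)
    (show (0 : Fin 2) ≠ 1 from by decide) K xK yK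
  -- `φ(M) ⊆ Z` for `M = (⁅Δ,Δ⁆ · Δ^l)⁻`, the subgroup of (∗) and of (N)
  set M : Subgroup D.PiC := (⁅D.PiX ⊓ D.DeltaC, D.PiX ⊓ D.DeltaC⁆ ⊔
    Subgroup.closure ((fun y : D.PiC => y ^ D.l) ''
      ((D.PiX ⊓ D.DeltaC : Subgroup D.PiC) : Set D.PiC))).topologicalClosure with hMdef
  have hemb : Topology.IsClosedEmbedding ((↑) : ↥(D.PiX ⊓ D.DeltaC) → D.PiC) := hΔc.isClosedEmbedding_subtypeVal
  have hZZc : IsClosed (((Z.comap φ).map (D.PiX ⊓ D.DeltaC).subtype : Subgroup D.PiC) : Set D.PiC) := by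
    rw [Subgroup.coe_map, Subgroup.coe_subtype]
    exact hemb.isClosedMap _ (by rw [Subgroup.coe_comap]; exact (isClosed_discrete _).preimage hφc)
  have hMZ : M ≤ (Z.comap φ).map (D.PiX ⊓ D.DeltaC).subtype := by
    refine Subgroup.topologicalClosure_minimal _ (sup_le ?_ ?_) hZZc
    · rw [Subgroup.commutator_le]
      intro p hp q hq
      refine ⟨⟨p, hp⟩ * ⟨q, hq⟩ * ⟨p, hp⟩⁻¹ * ⟨q, hq⟩⁻¹, ?_, rfl⟩
      change φ (⟨p, hp⟩ * ⟨q, hq⟩ * ⟨p, hp⟩⁻¹ * ⟨q, hq⟩⁻¹) ∈ Z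
      rw [map_mul, map_mul, map_mul, map_inv, map_inv]
      exact hZcomm _ _
    · rw [Subgroup.closure_le]
      rintro _ ⟨y, hy, rfl⟩
      refine ⟨⟨y, hy⟩ ^ D.l, ?_, rfl⟩
      change φ (⟨y, hy⟩ ^ D.l) ∈ Z
      rw [map_pow]
      exact hZpow _
  have hMcen : ∀ q ∈ M, ∃ m : ↥(D.PiX ⊓ D.DeltaC), (m : D.PiC) = q ∧ φ m ∈ Subgroup.center K := by
    intro q hq; obtain ⟨m, hm, hmeq⟩ := hMZ hq; exact ⟨m, hmeq, hZc hm⟩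
  -- (∗) for `t` and (N) for `c`: conjugation by `d = t c` sends `p ↦ n_p · p⁻¹` with `φ(n_p)` central
  have hdconj : ∀ p (hp : p ∈ D.PiX ⊓ D.DeltaC),
      ∃ n : ↥(D.PiX ⊓ D.DeltaC), φ n ∈ Subgroup.center K ∧ d * p * d⁻¹ = (n : D.PiC) * p⁻¹ := by
    intro p hp
    obtain ⟨m₁, hm₁, hc₁⟩ := hMcen _ (hneg c hc hcX p hp)
    have hcp : c * p * c⁻¹ = (m₁ : D.PiC) * p⁻¹ := by rw [hm₁]; group
    have hq : (m₁ : D.PiC) * p⁻¹ ∈ D.PiX ⊓ D.DeltaC := mul_mem m₁.2 (inv_mem hp)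
    obtain ⟨m₂, hm₂, hc₂⟩ := hMcen _ (D.star t htX _ hq)
    have htp : t * ((m₁ : D.PiC) * p⁻¹) * t⁻¹ = (m₂ : D.PiC) * ((m₁ : D.PiC) * p⁻¹) := by
      rw [hm₂]; group
    refine ⟨m₂ * m₁, by rw [map_mul]; exact Subgroup.mul_mem _ hc₂ hc₁, ?_⟩
    calc d * p * d⁻¹ = t * (c * p * c⁻¹) * t⁻¹ := by rw [hddef]; group
      _ = t * ((m₁ : D.PiC) * p⁻¹) * t⁻¹ := by rw [hcp]
      _ = (m₂ : D.PiC) * ((m₁ : D.PiC) * p⁻¹) := htp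
      _ = ((m₂ * m₁ : ↥(D.PiX ⊓ D.DeltaC)) : D.PiC) * p⁻¹ := by rw [Subgroup.coe_mul, mul_assoc]
  -- hence `φ ∘ c_d = φ` on `⁅Δ,Δ⁆⁻`: `[n_p p⁻¹, n_q q⁻¹] ↦ [φp⁻¹, φq⁻¹] = [φp, φq]` (`det(−1) = +1`)
  have hconj_mem : ∀ p ∈ D.PiX ⊓ D.DeltaC, d * p * d⁻¹ ∈ D.PiX ⊓ D.DeltaC := fun p hp => hΔn.conj_mem p hp d
  have hfix : ∀ u (hu : u ∈ (⁅D.PiX ⊓ D.DeltaC, D.PiX ⊓ D.DeltaC⁆).topologicalClosure)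
      (huΔ : u ∈ D.PiX ⊓ D.DeltaC), φ ⟨d * u * d⁻¹, hconj_mem u huΔ⟩ = φ ⟨u, huΔ⟩ := by
    intro u hu huΔ
    set cd : ↥(D.PiX ⊓ D.DeltaC) →* ↥(D.PiX ⊓ D.DeltaC) :=
      (MulAut.conjNormal d : MulAut ↥(D.PiX ⊓ D.DeltaC)).toMonoidHom with hcd
    have hcd_apply : ∀ v : ↥(D.PiX ⊓ D.DeltaC), ((cd v : ↥(D.PiX ⊓ D.DeltaC)) : D.PiC) = d * v * d⁻¹ :=
      fun v => by
        change ((MulAut.conjNormal d v : ↥(D.PiX ⊓ D.DeltaC)) : D.PiC) = _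
        exact MulAut.conjNormal_apply d v
    have hcdc : Continuous cd := by
      rw [hemb.isInducing.continuous_iff]
      have h2 : ((↑) : ↥(D.PiX ⊓ D.DeltaC) → D.PiC) ∘ cd =
          fun v : ↥(D.PiX ⊓ D.DeltaC) => d * (v : D.PiC) * d⁻¹ := funext fun v => hcd_apply v
      rw [h2]
      exact (continuous_const.mul continuous_subtype_val).mul continuous_const
    set T : Subgroup ↥(D.PiX ⊓ D.DeltaC) := (φ.comp cd).eqLocus φ with hT
    have hTc : IsClosed ((T.map (D.PiX ⊓ D.DeltaC).subtype : Subgroup D.PiC) : Set D.PiC) := by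
      rw [Subgroup.coe_map, Subgroup.coe_subtype]
      refine hemb.isClosedMap _ ?_
      have hset : (T : Set ↥(D.PiX ⊓ D.DeltaC)) = {v | (φ.comp cd) v = φ v} := rfl
      rw [hset]
      exact isClosed_eq (hφc.comp hcdc) hφc
    have hle : (⁅D.PiX ⊓ D.DeltaC, D.PiX ⊓ D.DeltaC⁆).topologicalClosure ≤
        T.map (D.PiX ⊓ D.DeltaC).subtype := by
      refine Subgroup.topologicalClosure_minimal _ ?_ hTc
      rw [Subgroup.commutator_le]
      intro p hp q hq
      obtain ⟨np, hnp, hp'⟩ := hdconj p hp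
      obtain ⟨nq, hnq, hq'⟩ := hdconj q hq
      refine ⟨⟨p, hp⟩ * ⟨q, hq⟩ * ⟨p, hp⟩⁻¹ * ⟨q, hq⟩⁻¹, ?_, rfl⟩
      change (φ.comp cd) _ = φ _
      have hcp : cd ⟨p, hp⟩ = np * ⟨p, hp⟩⁻¹ :=
        Subtype.ext (by rw [hcd_apply, Subgroup.coe_mul, Subgroup.coe_inv]; exact hp')
      have hcq : cd ⟨q, hq⟩ = nq * ⟨q, hq⟩⁻¹ :=
        Subtype.ext (by rw [hcd_apply, Subgroup.coe_mul, Subgroup.coe_inv]; exact hq')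
      simp only [MonoidHom.comp_apply, map_mul, map_inv, hcp, hcq]
      rw [commutator_central_mul hnp hnq]
      exact commutator_inv_inv_of_central _ _ (hZc (hZcomm _ _))
    obtain ⟨v, hv, hvu⟩ := hle hu
    rw [Subgroup.coe_subtype] at hvu
    have hvu' : v = ⟨u, huΔ⟩ := Subtype.ext hvu
    subst hvu'
    have hcu : cd ⟨u, huΔ⟩ = ⟨d * u * d⁻¹, hconj_mem u huΔ⟩ := Subtype.ext (hcd_apply _)
    have h : (φ.comp cd) ⟨u, huΔ⟩ = φ ⟨u, huΔ⟩ := hv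
    rwa [MonoidHom.comp_apply, hcu] at h
  -- the cusp `ε⁰`: `I_{ε⁰} = ⟨w⟩⁻`, `w = k [a,b] k⁻¹`, `φ w = [x_K, y_K]` of order `l`
  obtain ⟨k, hk, hIx⟩ := hcusp D.ε0
  set a : D.PiC := (gens 0 : D.PiC) with ha
  set b : D.PiC := (gens 1 : D.PiC) with hb
  set w : D.PiC := k * (a * b * a⁻¹ * b⁻¹) * k⁻¹ with hw
  have hcomm_mem : a * b * a⁻¹ * b⁻¹ ∈ ⁅D.PiX ⊓ D.DeltaC, D.PiX ⊓ D.DeltaC⁆ :=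
    Subgroup.commutator_mem_commutator (gens 0).2 (gens 1).2
  have hwC : w ∈ ⁅D.PiX ⊓ D.DeltaC, D.PiX ⊓ D.DeltaC⁆ :=
    (inferInstance : (⁅D.PiX ⊓ D.DeltaC, D.PiX ⊓ D.DeltaC⁆).Normal).conj_mem _ hcomm_mem k
  have hwΔ : w ∈ D.PiX ⊓ D.DeltaC := Subgroup.commutator_le_left _ _ hwC
  have hIC : D.inertia D.ε0 ≤ (⁅D.PiX ⊓ D.DeltaC, D.PiX ⊓ D.DeltaC⁆).topologicalClosure := by
    rw [hIx]
    exact Subgroup.topologicalClosure_mono (by rw [Subgroup.zpowers_le]; exact hwC)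
  have hIΔ : D.inertia D.ε0 ≤ D.PiX ⊓ D.DeltaC := fun v hv =>
    Subgroup.topologicalClosure_minimal _ (Subgroup.commutator_le_left _ _) hΔc (hIC hv)
  have hφw : φ ⟨w, hwΔ⟩ = xK * yK * xK⁻¹ * yK⁻¹ := by
    have hwe : (⟨w, hwΔ⟩ : ↥(D.PiX ⊓ D.DeltaC)) =
        ⟨k, hk⟩ * (gens 0 * gens 1 * (gens 0)⁻¹ * (gens 1)⁻¹) * ⟨k, hk⟩⁻¹ :=
      Subtype.ext (by simp only [hw, ha, hb, Subgroup.coe_mul, Subgroup.coe_inv])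
    rw [hwe, map_mul, map_mul, map_inv, map_mul, map_mul, map_mul, map_inv, map_inv, hφa, hφb]
    have hzc : xK * yK * xK⁻¹ * yK⁻¹ ∈ Subgroup.center K := hZc (hZcomm xK yK)
    rw [Subgroup.mem_center_iff.mp hzc (φ ⟨k, hk⟩), mul_inv_cancel_right]
  have hordw : orderOf (φ ⟨w, hwΔ⟩) = D.l := by rw [hφw]; exact hord
  -- `z″ z⁻¹ ∈ I_{ε⁰} ∩ Ker φ ⊆ ⟨w^l⟩⁻ ⊆ (Δ_X̲^l)⁻ ⊆ Ker(Δ_X̲ ↠ Δ_X̲^{ab} ⊗ ℤ/l)`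
  have hvI : z'' * z⁻¹ ∈ D.inertia D.ε0 := mul_mem hz'' (inv_mem hz)
  have hvΔ : z'' * z⁻¹ ∈ D.PiX ⊓ D.DeltaC := hIΔ hvI
  have hzΔ : z ∈ D.PiX ⊓ D.DeltaC := hIΔ hz
  have hφz'' : φ ⟨z'', hconj_mem z hzΔ⟩ = φ ⟨z, hzΔ⟩ := hfix z (hIC hz) hzΔ
  have hφv : φ ⟨z'' * z⁻¹, hvΔ⟩ = 1 := by
    have he : (⟨z'' * z⁻¹, hvΔ⟩ : ↥(D.PiX ⊓ D.DeltaC)) = ⟨z'', hconj_mem z hzΔ⟩ * ⟨z, hzΔ⟩⁻¹ :=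
      Subtype.ext rfl
    rw [he, map_mul, map_inv, hφz'', mul_inv_cancel]
  have hvw : z'' * z⁻¹ ∈ (Subgroup.zpowers (w ^ D.l)).topologicalClosure :=
    mem_closure_zpowers_pow_of_map_eq_one hΔc hφc hwΔ hl hordw (by rw [← hIx]; exact hvI) hvΔ hφv
  show _ ∈ (⁅D.DeltaXbar, D.DeltaXbar⁆ ⊔
    Subgroup.closure ((fun y : D.PiC => y ^ D.l) '' (D.DeltaXbar : Set D.PiC))).topologicalClosure
  refine Subgroup.topologicalClosure_minimal _ ?_ (Subgroup.isClosed_topologicalClosure _) hvw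
  rw [Subgroup.zpowers_le]
  refine Subgroup.le_topologicalClosure _ (Subgroup.mem_sup_right (Subgroup.subset_closure ?_))
  have hwXbar : w ∈ D.DeltaXbar := D.inertia_le_deltaXbar D.ε0
    (by rw [hIx]; exact Subgroup.le_topologicalClosure _ (Subgroup.mem_zpowers w))
  exact ⟨w, hwXbar, rfl⟩

end CuspGalois

end PuncturedEllipticData

end Literature.IUT.HodgeTheaters

end
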